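import Summits.AtomisticToContinuum.HydrodynamicLimit.Theorems.AntiMazurCoboundariesKineticWindowGronwallBoostGibbs
import Summits.AtomisticToContinuum.HydrodynamicLimit.Theorems.AntiMazurCoboundariesKineticWindowGronwallBoostFlow
import Literature.MathematicalPhysics.KineticTheory.HardSphereEulerProofs
import HarnessLib

/-!
# The local Gibbs law with general profiles under a velocity translation

Crux `Summit.AtomisticToContinuum.HydrodynamicLimit.Theses.LambertianContactSwap.ContactAngleEquidistribution`
(stmt-AtomisticToContinuum-12097), line `Sketch` v7, registered stub `localGibbsLaw_map_velShift` (stub group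
`boostGibbsGeneral`). Line v7 extends the proved equilibrium case of the crux to drifting Gibbs laws by Galilean
covariance; this file is the MEASURE side for GENERAL profiles: the velocity translation
`velShift u z = (x_i, v_i + u)_i` (`…KineticWindowGronwallBoostGibbs`) pushes the local Gibbs law
`LG_N(a₀, u₀, θ₀) = localGibbsLaw σ a₀ u₀ θ₀ N Φ` of `HardSphereEuler` forward to `LG_N(a₀, u₀ + u, θ₀)`, for ALL
profiles `a₀, u₀, θ₀` (no sign, positivity, continuity or measurability hypothesis) and arbitrary type-fixing flows
`Φ, Ψ`. The constant-profile case is the tree's `localGibbsLaw_const_map_velShift` (via the rung-0 product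
structure, which is not available here).

PROOF. (i) Pointwise, the one-particle profile transforms as
`a₀(x) M_{1, u₀(x) + u, θ₀(x)}(v + u) = a₀(x) M_{1, u₀(x), θ₀(x)}(v)` (`‖(v + u) - (u₀ x + u)‖ = ‖v - u₀ x‖`), so the
tensor powers agree along `velShift u`, the hard-sphere domain is `velShift`-invariant, and the two canonical
partition functions agree by the volume-preserving change of variables `z ↦ velShift u z`
(`measurePreserving_velShift_volume`, `MeasurePreserving.integral_comp`); hence
`canonicalDensity (profile u₀ + u) ∘ velShift u = canonicalDensity (profile u₀)`. (ii) For a measure-preserving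
measurable embedding `e` and ANY density `g` (no measurability), `e_# (μ · (g ∘ e)) = ν · g`
(`map_withDensity_comp_emb`, via `MeasurePreserving.lintegral_comp_emb` on the restricted measures); applied to
`e = velShift u`, `μ = ν = volume` and the flow-free form `localGibbsLaw_eq`/`localGibbsMeasure`.
References: folklore (Galilean invariance of hard-sphere dynamics and of the local equilibrium states; CIP 1994 §4.2,
GST 2013 §1.1).
-/

noncomputable section

open MeasureTheory Set Filter Function
open scoped ENNReal
open Literature.Analysis Literature.Analysis.FluidPDE Literature.MathematicalPhysics.KineticTheory
open Summit.AtomisticToContinuum.HydrodynamicLimit.Theorems.KineticWindowGronwallBoost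

namespace Summit.AtomisticToContinuum.HydrodynamicLimit.Theorems.ContactAngleEquidistributionSketch

/-! ### A measure-theoretic identity -/

/-- **Transport of a pulled-back density along a measure-preserving embedding**: if `e_# μ = ν` and `e` is a
measurable embedding then `e_# (μ.withDensity (g ∘ e)) = ν.withDensity g` for EVERY `g : β → ℝ≥0∞` (no
measurability: on each measurable `s`, `∫⁻_{e ⁻¹' s} g ∘ e dμ = ∫⁻_s g dν` by `MeasurePreserving.lintegral_comp_emb` for
the restricted measures). [folklore] -/
theorem map_withDensity_comp_emb {α β : Type*} [MeasurableSpace α] [MeasurableSpace β] {μ : Measure α}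
    {ν : Measure β} {e : α → β} (he : MeasurePreserving e μ ν) (hemb : MeasurableEmbedding e) (g : β → ℝ≥0∞) :
    (μ.withDensity (g ∘ e)).map e = ν.withDensity g := by
  ext s hs
  rw [Measure.map_apply he.measurable hs, withDensity_apply _ (he.measurable hs), withDensity_apply _ hs]
  exact (he.restrict_preimage_emb hemb s).lintegral_comp_emb hemb g

/-! ### The local Gibbs profile and the canonical density under `velShift u` -/

variable (a₀ θ₀ : T3 → ℝ) (u₀ : T3 → V3) (u : V3)

/-- The one-particle local Gibbs profile transforms pointwise under the velocity translation:
`a₀(x) M_{1, u₀(x) + u, θ₀(x)}(v + u) = a₀(x) M_{1, u₀(x), θ₀(x)}(v)`. [folklore] -/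
theorem localGibbsProfile_add_vel (x : T3) (v : V3) :
    localGibbsProfile a₀ (fun y => u₀ y + u) θ₀ (x, v + u) = localGibbsProfile a₀ u₀ θ₀ (x, v) := by
  simp only [localGibbsProfile, localMaxwellian, add_sub_add_right_eq_sub]

/-- Tensor powers of the profile agree along `velShift u`. [folklore] -/
theorem tensorPow_localGibbsProfile_velShift {n : ℕ} (z : Config n (Fin 3) T3) :
    tensorPow n (localGibbsProfile a₀ (fun y => u₀ y + u) θ₀) (velShift u z) =
      tensorPow n (localGibbsProfile a₀ u₀ θ₀) z := by
  simp only [tensorPow, velShift_apply, localGibbsProfile_add_vel]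

/-- The hard-core-restricted tensor powers agree along `velShift u` (the domain is `velShift`-invariant). [folklore] -/
theorem indicator_tensorPow_localGibbsProfile_velShift (ε : ℝ) {n : ℕ} (z : Config n (Fin 3) T3) :
    (hardSphereDomain (Torus.geometry (Fin 3)) n ε).indicator
        (tensorPow n (localGibbsProfile a₀ (fun y => u₀ y + u) θ₀)) (velShift u z) =
      (hardSphereDomain (Torus.geometry (Fin 3)) n ε).indicator (tensorPow n (localGibbsProfile a₀ u₀ θ₀)) z := by
  by_cases hz : z ∈ hardSphereDomain (Torus.geometry (Fin 3)) n ε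
  · rw [indicator_of_mem hz, indicator_of_mem (velShift_mem_hardSphereDomain_iff.2 hz),
      tensorPow_localGibbsProfile_velShift]
  · rw [indicator_of_notMem hz, indicator_of_notMem (mt velShift_mem_hardSphereDomain_iff.1 hz)]

/-- **The canonical partition functions agree**: `𝒵_n(a₀, u₀ + u, θ₀) = 𝒵_n(a₀, u₀, θ₀)` (volume-preserving change
of variables `z ↦ velShift u z` in the Bochner integral). [folklore] -/
theorem canonicalPartition_localGibbsProfile_add_vel (ε : ℝ) (n : ℕ) :
    canonicalPartition (Torus.geometry (Fin 3)) ε n (localGibbsProfile a₀ (fun y => u₀ y + u) θ₀) =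
      canonicalPartition (Torus.geometry (Fin 3)) ε n (localGibbsProfile a₀ u₀ θ₀) := by
  unfold canonicalPartition
  rw [← (measurePreserving_velShift_volume u).integral_comp (measurableEmbedding_velShift u)]
  simp only [indicator_tensorPow_localGibbsProfile_velShift]

/-- **The canonical densities agree along `velShift u`**:
`f_{n,0}(a₀, u₀ + u, θ₀) (velShift u z) = f_{n,0}(a₀, u₀, θ₀) z`. [folklore] -/
theorem canonicalDensity_localGibbsProfile_velShift (ε : ℝ) {n : ℕ} (z : Config n (Fin 3) T3) :
    canonicalDensity (Torus.geometry (Fin 3)) ε n (localGibbsProfile a₀ (fun y => u₀ y + u) θ₀) (velShift u z) =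
      canonicalDensity (Torus.geometry (Fin 3)) ε n (localGibbsProfile a₀ u₀ θ₀) z := by
  simp only [canonicalDensity, canonicalPartition_localGibbsProfile_add_vel,
    indicator_tensorPow_localGibbsProfile_velShift]

/-! ### The local Gibbs law under `velShift u` -/

/-- **The flow-free local Gibbs measure under `velShift u`**, general profiles:
`(velShift u)_# LG_N(a₀, u₀, θ₀) = LG_N(a₀, u₀ + u, θ₀)`. [folklore] -/
theorem localGibbsMeasure_map_velShift (σ : ℝ) (N : ℕ) :
    (localGibbsMeasure σ a₀ u₀ θ₀ N).map (velShift u) = localGibbsMeasure σ a₀ (fun y => u₀ y + u) θ₀ N := by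
  have hF : (fun z : Config (N + 1) (Fin 3) T3 => ENNReal.ofReal
      (canonicalDensity (Torus.geometry (Fin 3)) (hsDiameter σ N) (N + 1) (localGibbsProfile a₀ u₀ θ₀) z)) =
      (fun z => ENNReal.ofReal (canonicalDensity (Torus.geometry (Fin 3)) (hsDiameter σ N) (N + 1)
        (localGibbsProfile a₀ (fun y => u₀ y + u) θ₀) z)) ∘ velShift u := by
    funext z
    rw [comp_apply, canonicalDensity_localGibbsProfile_velShift]
  rw [localGibbsMeasure, localGibbsMeasure, hF]
  exact map_withDensity_comp_emb (measurePreserving_velShift_volume u) (measurableEmbedding_velShift u) _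

/-- **THE LOCAL GIBBS LAW UNDER A VELOCITY TRANSLATION, GENERAL PROFILES**:
`(velShift u)_# LG_N(a₀, u₀, θ₀) = LG_N(a₀, u₀ + u, θ₀)` for all profiles `a₀, u₀, θ₀`, every `u ∈ ℝ³`, every `N` and
arbitrary type-fixing flows `Φ, Ψ` (the law does not depend on them, `localGibbsLaw_eq`). [folklore] -/
theorem localGibbsLaw_map_velShift (σ : ℝ) (a₀ θ₀ : T3 → ℝ) (u₀ : T3 → V3) (u : V3) (N : ℕ)
    (Φ Ψ : HardSphereFlow (Torus.geometry (Fin 3)) (hsDiameter σ N) (N + 1)) :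
    (localGibbsLaw σ a₀ u₀ θ₀ N Φ).map (velShift u) = localGibbsLaw σ a₀ (fun x => u₀ x + u) θ₀ N Ψ := by
  rw [localGibbsLaw_eq, localGibbsLaw_eq, localGibbsMeasure_map_velShift]

/-- Expectations in the translated frame, general profiles (no measurability of `F`):
`∫⁻ F dLG_N(a₀, u₀ + u, θ₀) = ∫⁻ F ∘ velShift u dLG_N(a₀, u₀, θ₀)`. [folklore] -/
theorem lintegral_localGibbsLaw_map_velShift (σ : ℝ) (N : ℕ)
    (Φ Ψ : HardSphereFlow (Torus.geometry (Fin 3)) (hsDiameter σ N) (N + 1)) (F : Config (N + 1) (Fin 3) T3 → ℝ≥0∞) :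
    ∫⁻ z, F z ∂(localGibbsLaw σ a₀ (fun x => u₀ x + u) θ₀ N Ψ) =
      ∫⁻ z, F (velShift u z) ∂(localGibbsLaw σ a₀ u₀ θ₀ N Φ) := by
  rw [← localGibbsLaw_map_velShift σ a₀ θ₀ u₀ u N Φ Ψ, (measurableEmbedding_velShift u).lintegral_map]

/-- Masses of measurable sets in the translated frame, general profiles:
`LG_N(a₀, u₀ + u, θ₀)(S) = LG_N(a₀, u₀, θ₀)(velShift u ⁻¹' S)`. [folklore] -/
theorem localGibbsLaw_map_velShift_apply (σ : ℝ) (N : ℕ)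
    (Φ Ψ : HardSphereFlow (Torus.geometry (Fin 3)) (hsDiameter σ N) (N + 1))
    {S : Set (Config (N + 1) (Fin 3) T3)} (hS : MeasurableSet S) :
    localGibbsLaw σ a₀ (fun x => u₀ x + u) θ₀ N Ψ S = localGibbsLaw σ a₀ u₀ θ₀ N Φ (velShift u ⁻¹' S) := by
  rw [← localGibbsLaw_map_velShift σ a₀ θ₀ u₀ u N Φ Ψ, Measure.map_apply (measurable_velShift u) hS]

end Summit.AtomisticToContinuum.HydrodynamicLimit.Theorems.ContactAngleEquidistributionSketch

end
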